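/-
Copyright (c) 2026. All rights reserved.
Released under Apache 2.0 license as described in the file LICENSE.
Authors: abc-iut cell, seat abc-iut-w5-d218 (gen 3).
-/
import Mathlib.GroupTheory.Nilpotent
import Mathlib.Algebra.Group.Pointwise.Set.ListOfFn

/-!
# Commutator width relative to a generating list, modulo the lower central series

Let `G` be a group generated by the entries of a list `l = [a₁, …, a_d]`.  For a subgroup `K` write
`T_K(l) := {⁅y₁, a₁⁆ ⋯ ⁅y_d, a_d⁆ | yᵢ ∈ K}` (in Lean, the pointwise product of the list of sets
`(fun y ↦ ⁅y, aᵢ⁆) '' K`; no definition is introduced, the expression is spelled out).  The classical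
"collection" lemma behind Serre's theorem on finitely generated pro-`p` groups (J. D. Dixon, M. du Sautoy,
A. Mann, D. Segal, *Analytic pro-`p` groups*, 2nd ed., proof of Prop. 1.19; D. Segal, *Words*, §1.2):

* `commutator_subset_listProd_mul_lowerCentralSeries` — for every `n`,
  `[G, G] ⊆ T_G(l) · γ_{n+1}(G)`: every element of the derived group is a product of `d` commutators
  `⁅xᵢ, aᵢ⁆`, IN THE ORDER OF THE LIST, up to an element of the `(n+1)`-st term of the lower central
  series (`γ₁ = G`, `γ₂ = [G,G]`, `γ_{k+1} = [γ_k, G]`; Mathlib: `(⊤ : Subgroup G).lowerCentralSeries n`);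
* `commutator_eq_listProd_of_lowerCentralSeries_eq_bot` — hence in a NILPOTENT group generated by
  `a₁, …, a_d` every element of `[G, G]` is a product `⁅x₁, a₁⁆ ⋯ ⁅x_d, a_d⁆` (commutator width `≤ d`
  relative to the generators); in particular for finite `p`-groups (`IsPGroup.isNilpotent`).

Proof: modulo `γ_{n+2}` the commutators `⁅y, x⁆` with `y ∈ γ_n` are central and the pairing
`(y, x) ↦ ⁅y, x⁆` is bimultiplicative, so `γ_{n+1} = [γ_n, G] ≡ T_{γ_n}(l)` and
`T_G(l) · T_{γ_n}(l) ≡ T_G(l)` (merge `⁅xᵢ, aᵢ⁆⁅yᵢ, aᵢ⁆ ≡ ⁅xᵢyᵢ, aᵢ⁆`); induct on `n`.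
Consumer: closedness of the derived subgroup of a topologically finitely generated pro-`p` group
(`ProPDerivedClosed.lean`), whence Serre's theorem (DdSMS Thm 1.17).

[cite: DDMSAnalyticProP1999, Prop 1.19 (proof), Thm 1.17]
-/

namespace Literature.GroupTheory

open scoped Pointwise commutatorElement

variable {G : Type*} [Group G]

/-! ### The sets `T_K(l) = {⁅y₁,a₁⁆ ⋯ ⁅y_d,a_d⁆ | yᵢ ∈ K}`: elementary membership facts -/

/-- `1 ∈ T_K(l)` (all `yᵢ = 1`). [cite: DDMSAnalyticProP1999, Prop 1.19 (proof)] -/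
theorem one_mem_listProd_commSet (K : Subgroup G) (l : List G) :
    (1 : G) ∈ (l.map fun a => (fun y : G => ⁅y, a⁆) '' (K : Set G)).prod := by
  induction l with
  | nil => simp
  | cons a l ih =>
    rw [List.map_cons, List.prod_cons]
    exact Set.mem_mul.mpr ⟨1, ⟨1, K.one_mem, commutatorElement_one_left a⟩, 1, ih, one_mul 1⟩

/-- For `a` an entry of `l` and `y ∈ K`, `⁅y, a⁆ ∈ T_K(l)` (all other `yᵢ = 1`).
[cite: DDMSAnalyticProP1999, Prop 1.19 (proof)] -/
theorem comm_mem_listProd_commSet (K : Subgroup G) {l : List G} {a y : G} (ha : a ∈ l)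
    (hy : y ∈ K) : ⁅y, a⁆ ∈ (l.map fun a => (fun y : G => ⁅y, a⁆) '' (K : Set G)).prod := by
  induction l with
  | nil => simp at ha
  | cons b l ih =>
    rw [List.map_cons, List.prod_cons]
    rcases List.mem_cons.mp ha with rfl | ha'
    · exact Set.mem_mul.mpr ⟨⁅y, a⁆, ⟨y, hy, rfl⟩, 1, one_mem_listProd_commSet K l, mul_one _⟩
    · exact Set.mem_mul.mpr ⟨1, ⟨1, K.one_mem, commutatorElement_one_left b⟩, ⁅y, a⁆, ih ha',
        one_mul _⟩

/-- `T_K(l) ⊆ ⁅K, G⁆`. [cite: DDMSAnalyticProP1999, Prop 1.19 (proof)] -/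
theorem listProd_commSet_subset_commutator (K : Subgroup G) (l : List G) :
    (l.map fun a => (fun y : G => ⁅y, a⁆) '' (K : Set G)).prod ⊆
      ((⁅K, (⊤ : Subgroup G)⁆ : Subgroup G) : Set G) := by
  induction l with
  | nil => simp
  | cons a l ih =>
    rw [List.map_cons, List.prod_cons]
    rintro _ ⟨c, ⟨y, hy, rfl⟩, u, hu, rfl⟩
    exact mul_mem (Subgroup.commutator_mem_commutator hy (Subgroup.mem_top a)) (ih hu)

/-- In particular `T_G(l) ⊆ [G, G]`. [cite: DDMSAnalyticProP1999, Prop 1.19 (proof)] -/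
theorem listProd_commSet_top_subset_commutator (l : List G) :
    (l.map fun a => (fun y : G => ⁅y, a⁆) '' ((⊤ : Subgroup G) : Set G)).prod ⊆
      (commutator G : Set G) :=
  listProd_commSet_subset_commutator ⊤ l

/-! ### Computing modulo `γ_{n+2}`: centrality and bimultiplicativity of `(y, x) ↦ ⁅y, x⁆`, `y ∈ γ_n` -/

section Modulo

variable (n : ℕ)

/-- The terms of the lower central series are normal. [cite: DDMSAnalyticProP1999, §1.2] -/
theorem lowerCentralSeries_top_normal (k : ℕ) : ((⊤ : Subgroup G).lowerCentralSeries k).Normal := by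
  infer_instance

/-- For `z ∈ γ_{n+1}`, the class of `z` in `G ⧸ γ_{n+2}` is central.
[cite: DDMSAnalyticProP1999, Prop 1.19 (proof)] -/
theorem mk_mul_mk_comm_of_mem_lowerCentralSeries {z : G}
    (hz : z ∈ (⊤ : Subgroup G).lowerCentralSeries (n + 1)) (g : G) :
    (QuotientGroup.mk g : G ⧸ (⊤ : Subgroup G).lowerCentralSeries (n + 2)) * QuotientGroup.mk z =
      QuotientGroup.mk z * QuotientGroup.mk g := by
  rw [← QuotientGroup.mk_mul, ← QuotientGroup.mk_mul, QuotientGroup.eq]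
  have : (g * z)⁻¹ * (z * g) = ⁅z⁻¹, g⁻¹⁆ := by
    simp only [commutatorElement_def, mul_inv_rev, inv_inv, mul_assoc]
  rw [this, Subgroup.lowerCentralSeries_succ]
  exact Subgroup.commutator_mem_commutator (inv_mem hz) (Subgroup.mem_top _)

/-- For `y ∈ γ_n` (and any `x`), `⁅x·y, a⁆ ≡ ⁅x, a⁆ · ⁅y, a⁆ (mod γ_{n+2})`.
[cite: DDMSAnalyticProP1999, Prop 1.19 (proof)] -/
theorem mk_comm_mul_left {x y : G} (hy : y ∈ (⊤ : Subgroup G).lowerCentralSeries n) (a : G) :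
    (QuotientGroup.mk ⁅x * y, a⁆ : G ⧸ (⊤ : Subgroup G).lowerCentralSeries (n + 2)) =
      QuotientGroup.mk ⁅x, a⁆ * QuotientGroup.mk ⁅y, a⁆ := by
  have hid : ⁅x * y, a⁆ = (x * ⁅y, a⁆ * x⁻¹) * ⁅x, a⁆ := by
    simp only [commutatorElement_def, mul_assoc, inv_mul_cancel_left, mul_inv_rev]
  have hya : ⁅y, a⁆ ∈ (⊤ : Subgroup G).lowerCentralSeries (n + 1) := by
    rw [Subgroup.lowerCentralSeries_succ]
    exact Subgroup.commutator_mem_commutator hy (Subgroup.mem_top a)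
  rw [hid, QuotientGroup.mk_mul, QuotientGroup.mk_mul, QuotientGroup.mk_mul, QuotientGroup.mk_inv,
    mk_mul_mk_comm_of_mem_lowerCentralSeries n hya x, mul_inv_cancel_right,
    mk_mul_mk_comm_of_mem_lowerCentralSeries n hya ⁅x, a⁆]

/-- For `y ∈ γ_n`, `⁅y, x·x'⁆ ≡ ⁅y, x⁆ · ⁅y, x'⁆ (mod γ_{n+2})`.
[cite: DDMSAnalyticProP1999, Prop 1.19 (proof)] -/
theorem mk_comm_mul_right {y : G} (hy : y ∈ (⊤ : Subgroup G).lowerCentralSeries n) (x x' : G) :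
    (QuotientGroup.mk ⁅y, x * x'⁆ : G ⧸ (⊤ : Subgroup G).lowerCentralSeries (n + 2)) =
      QuotientGroup.mk ⁅y, x⁆ * QuotientGroup.mk ⁅y, x'⁆ := by
  have hid : ⁅y, x * x'⁆ = ⁅y, x⁆ * (x * ⁅y, x'⁆ * x⁻¹) := by
    simp only [commutatorElement_def, mul_assoc, inv_mul_cancel_left, mul_inv_rev]
  have hyx' : ⁅y, x'⁆ ∈ (⊤ : Subgroup G).lowerCentralSeries (n + 1) := by
    rw [Subgroup.lowerCentralSeries_succ]
    exact Subgroup.commutator_mem_commutator hy (Subgroup.mem_top x')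
  rw [hid, QuotientGroup.mk_mul, QuotientGroup.mk_mul, QuotientGroup.mk_mul, QuotientGroup.mk_inv,
    mk_mul_mk_comm_of_mem_lowerCentralSeries n hyx' x, mul_inv_cancel_right]

/-- For `y ∈ γ_n`, `⁅y⁻¹, a⁆ ≡ ⁅y, a⁆⁻¹ (mod γ_{n+2})`. [cite: DDMSAnalyticProP1999, Prop 1.19 (proof)] -/
theorem mk_comm_inv_left {y : G} (hy : y ∈ (⊤ : Subgroup G).lowerCentralSeries n) (a : G) :
    (QuotientGroup.mk ⁅y⁻¹, a⁆ : G ⧸ (⊤ : Subgroup G).lowerCentralSeries (n + 2)) =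
      (QuotientGroup.mk ⁅y, a⁆)⁻¹ := by
  refine eq_inv_of_mul_eq_one_left ?_
  rw [← mk_comm_mul_left n hy a, inv_mul_cancel, commutatorElement_one_left, QuotientGroup.mk_one]

/-- For `y ∈ γ_n`, `⁅y, x⁻¹⁆ ≡ ⁅y, x⁆⁻¹ (mod γ_{n+2})`. [cite: DDMSAnalyticProP1999, Prop 1.19 (proof)] -/
theorem mk_comm_inv_right {y : G} (hy : y ∈ (⊤ : Subgroup G).lowerCentralSeries n) (x : G) :
    (QuotientGroup.mk ⁅y, x⁻¹⁆ : G ⧸ (⊤ : Subgroup G).lowerCentralSeries (n + 2)) =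
      (QuotientGroup.mk ⁅y, x⁆)⁻¹ := by
  refine eq_inv_of_mul_eq_one_left ?_
  rw [← mk_comm_mul_right n hy, inv_mul_cancel, commutatorElement_one_right, QuotientGroup.mk_one]

/-- MERGE: for `u ∈ T_K(l)` and `v ∈ T_{γ_n}(l)` with `γ_n ≤ K`, `u · v ≡ w (mod γ_{n+2})` for some
`w ∈ T_K(l)` (merge `⁅xᵢ, aᵢ⁆ ⁅yᵢ, aᵢ⁆ ≡ ⁅xᵢyᵢ, aᵢ⁆`, the `⁅yᵢ, aᵢ⁆` being central).
[cite: DDMSAnalyticProP1999, Prop 1.19 (proof)] -/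
theorem exists_mk_mul_mk_eq_of_mem_listProd (K : Subgroup G)
    (hK : (⊤ : Subgroup G).lowerCentralSeries n ≤ K) (l : List G) {u v : G}
    (hu : u ∈ (l.map fun a => (fun y : G => ⁅y, a⁆) '' (K : Set G)).prod)
    (hv : v ∈ (l.map fun a => (fun y : G => ⁅y, a⁆) ''
      (((⊤ : Subgroup G).lowerCentralSeries n : Subgroup G) : Set G)).prod) :
    ∃ w ∈ (l.map fun a => (fun y : G => ⁅y, a⁆) '' (K : Set G)).prod,
      (QuotientGroup.mk u : G ⧸ (⊤ : Subgroup G).lowerCentralSeries (n + 2)) * QuotientGroup.mk v =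
        QuotientGroup.mk w := by
  induction l generalizing u v with
  | nil =>
    simp only [List.map_nil, List.prod_nil, Set.mem_one] at hu hv ⊢
    exact ⟨1, rfl, by rw [hu, hv, QuotientGroup.mk_one, one_mul]⟩
  | cons a l ih =>
    rw [List.map_cons, List.prod_cons] at hu hv ⊢
    obtain ⟨_, ⟨x, hx, rfl⟩, u', hu', rfl⟩ := Set.mem_mul.mp hu
    obtain ⟨_, ⟨y, hy, rfl⟩, v', hv', rfl⟩ := Set.mem_mul.mp hv
    obtain ⟨w', hw', hw'eq⟩ := ih hu' hv'
    refine ⟨⁅x * y, a⁆ * w', Set.mem_mul.mpr ⟨⁅x * y, a⁆, ⟨x * y, mul_mem hx (hK hy), rfl⟩, w', hw',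
      rfl⟩, ?_⟩
    have hya : ⁅y, a⁆ ∈ (⊤ : Subgroup G).lowerCentralSeries (n + 1) := by
      rw [Subgroup.lowerCentralSeries_succ]
      exact Subgroup.commutator_mem_commutator hy (Subgroup.mem_top a)
    rw [QuotientGroup.mk_mul, QuotientGroup.mk_mul, QuotientGroup.mk_mul, mk_comm_mul_left n hy,
      ← hw'eq, mul_assoc, mul_assoc, ← mul_assoc (QuotientGroup.mk u'),
      mk_mul_mk_comm_of_mem_lowerCentralSeries n hya u', mul_assoc]

/-- INVERSE: for `v ∈ T_{γ_n}(l)`, `v⁻¹ ≡ w (mod γ_{n+2})` for some `w ∈ T_{γ_n}(l)`.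
[cite: DDMSAnalyticProP1999, Prop 1.19 (proof)] -/
theorem exists_mk_inv_eq_of_mem_listProd (l : List G) {v : G}
    (hv : v ∈ (l.map fun a => (fun y : G => ⁅y, a⁆) ''
      (((⊤ : Subgroup G).lowerCentralSeries n : Subgroup G) : Set G)).prod) :
    ∃ w ∈ (l.map fun a => (fun y : G => ⁅y, a⁆) ''
      (((⊤ : Subgroup G).lowerCentralSeries n : Subgroup G) : Set G)).prod,
      (QuotientGroup.mk v : G ⧸ (⊤ : Subgroup G).lowerCentralSeries (n + 2))⁻¹ =
        QuotientGroup.mk w := by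
  induction l generalizing v with
  | nil =>
    simp only [List.map_nil, List.prod_nil, Set.mem_one] at hv ⊢
    exact ⟨1, rfl, by rw [hv, QuotientGroup.mk_one, inv_one]⟩
  | cons a l ih =>
    rw [List.map_cons, List.prod_cons] at hv ⊢
    obtain ⟨_, ⟨y, hy, rfl⟩, v', hv', rfl⟩ := Set.mem_mul.mp hv
    obtain ⟨w', hw', hw'eq⟩ := ih hv'
    refine ⟨⁅y⁻¹, a⁆ * w', Set.mem_mul.mpr ⟨⁅y⁻¹, a⁆, ⟨y⁻¹, inv_mem hy, rfl⟩, w', hw', rfl⟩, ?_⟩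
    have hya : ⁅y, a⁆ ∈ (⊤ : Subgroup G).lowerCentralSeries (n + 1) := by
      rw [Subgroup.lowerCentralSeries_succ]
      exact Subgroup.commutator_mem_commutator hy (Subgroup.mem_top a)
    rw [QuotientGroup.mk_mul, QuotientGroup.mk_mul, mul_inv_rev, hw'eq, mk_comm_inv_left n hy,
      ← QuotientGroup.mk_inv]
    -- `(mk ⁅y,a⁆)⁻¹ = mk ⁅y,a⁆⁻¹` is central as well
    have hc := mk_mul_mk_comm_of_mem_lowerCentralSeries n (inv_mem hya) w'
    exact hc

/-- STEP, generators: if the entries of `l` generate `G`, then for `y ∈ γ_n` and every `x`,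
`⁅y, x⁆ ≡ w (mod γ_{n+2})` for some `w ∈ T_{γ_n}(l)` (bimultiplicativity; induction on `x` as a word
in the generators). [cite: DDMSAnalyticProP1999, Prop 1.19 (proof)] -/
theorem exists_mk_comm_eq_of_closure_eq_top {l : List G}
    (hl : Subgroup.closure {a : G | a ∈ l} = ⊤) {y : G}
    (hy : y ∈ (⊤ : Subgroup G).lowerCentralSeries n) (x : G) :
    ∃ w ∈ (l.map fun a => (fun y : G => ⁅y, a⁆) ''
      (((⊤ : Subgroup G).lowerCentralSeries n : Subgroup G) : Set G)).prod,
      (QuotientGroup.mk ⁅y, x⁆ : G ⧸ (⊤ : Subgroup G).lowerCentralSeries (n + 2)) =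
        QuotientGroup.mk w := by
  have hx : x ∈ Subgroup.closure {a : G | a ∈ l} := by rw [hl]; exact Subgroup.mem_top x
  induction hx using Subgroup.closure_induction with
  | mem a ha =>
    exact ⟨⁅y, a⁆, comm_mem_listProd_commSet _ ha hy, rfl⟩
  | one =>
    exact ⟨1, one_mem_listProd_commSet _ l, by rw [commutatorElement_one_right]⟩
  | mul x x' _ _ ihx ihx' =>
    obtain ⟨w, hw, hweq⟩ := ihx
    obtain ⟨w', hw', hw'eq⟩ := ihx'
    obtain ⟨w'', hw'', hw''eq⟩ := exists_mk_mul_mk_eq_of_mem_listProd n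
      ((⊤ : Subgroup G).lowerCentralSeries n) le_rfl l hw hw'
    exact ⟨w'', hw'', by rw [mk_comm_mul_right n hy, hweq, hw'eq, hw''eq]⟩
  | inv x _ ihx =>
    obtain ⟨w, hw, hweq⟩ := ihx
    obtain ⟨w', hw', hw'eq⟩ := exists_mk_inv_eq_of_mem_listProd n l hw
    exact ⟨w', hw', by rw [mk_comm_inv_right n hy, hweq, hw'eq]⟩

/-- STEP: if the entries of `l` generate `G`, every `z ∈ γ_{n+1} = [γ_n, G]` satisfies
`z ≡ w (mod γ_{n+2})` for some `w ∈ T_{γ_n}(l)`. [cite: DDMSAnalyticProP1999, Prop 1.19 (proof)] -/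
theorem exists_mk_eq_of_mem_lowerCentralSeries_succ {l : List G}
    (hl : Subgroup.closure {a : G | a ∈ l} = ⊤) {z : G}
    (hz : z ∈ (⊤ : Subgroup G).lowerCentralSeries (n + 1)) :
    ∃ w ∈ (l.map fun a => (fun y : G => ⁅y, a⁆) ''
      (((⊤ : Subgroup G).lowerCentralSeries n : Subgroup G) : Set G)).prod,
      (QuotientGroup.mk z : G ⧸ (⊤ : Subgroup G).lowerCentralSeries (n + 2)) =
        QuotientGroup.mk w := by
  rw [Subgroup.mem_lowerCentralSeries_succ_iff] at hz
  induction hz using Subgroup.closure_induction with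
  | mem c hc =>
    obtain ⟨y, hy, x, -, rfl⟩ := hc
    exact exists_mk_comm_eq_of_closure_eq_top n hl hy x
  | one => exact ⟨1, one_mem_listProd_commSet _ l, rfl⟩
  | mul z z' _ _ ih ih' =>
    obtain ⟨w, hw, hweq⟩ := ih
    obtain ⟨w', hw', hw'eq⟩ := ih'
    obtain ⟨w'', hw'', hw''eq⟩ := exists_mk_mul_mk_eq_of_mem_listProd n
      ((⊤ : Subgroup G).lowerCentralSeries n) le_rfl l hw hw'
    exact ⟨w'', hw'', by rw [QuotientGroup.mk_mul, hweq, hw'eq, hw''eq]⟩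
  | inv z _ ih =>
    obtain ⟨w, hw, hweq⟩ := ih
    obtain ⟨w', hw', hw'eq⟩ := exists_mk_inv_eq_of_mem_listProd n l hw
    exact ⟨w', hw', by rw [QuotientGroup.mk_inv, hweq, hw'eq]⟩

end Modulo

/-! ### The width theorem -/

/-- **Commutator width modulo the lower central series.** If the entries `a₁, …, a_d` of `l`
generate `G`, then for every `n` every element of `[G, G]` is of the form
`⁅x₁, a₁⁆ ⋯ ⁅x_d, a_d⁆ · z` with `z ∈ γ_{n+1}(G)`:  `[G,G] ⊆ T_G(l) · γ_{n+1}`.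
[cite: DDMSAnalyticProP1999, Prop 1.19 (proof)] -/
theorem commutator_subset_listProd_mul_lowerCentralSeries {l : List G}
    (hl : Subgroup.closure {a : G | a ∈ l} = ⊤) (n : ℕ) :
    (commutator G : Set G) ⊆
      (l.map fun a => (fun y : G => ⁅y, a⁆) '' ((⊤ : Subgroup G) : Set G)).prod *
        (((⊤ : Subgroup G).lowerCentralSeries (n + 1) : Subgroup G) : Set G) := by
  induction n with
  | zero =>
    intro g hg
    exact Set.mem_mul.mpr ⟨1, one_mem_listProd_commSet ⊤ l, g,
      by rw [zero_add, Subgroup.top_lowerCentralSeries_one]; exact hg, one_mul g⟩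
  | succ n ih =>
    intro g hg
    obtain ⟨u, hu, z, hz, rfl⟩ := Set.mem_mul.mp (ih hg)
    obtain ⟨w, hw, hweq⟩ := exists_mk_eq_of_mem_lowerCentralSeries_succ n hl hz
    obtain ⟨m, hm, hmeq⟩ := exists_mk_mul_mk_eq_of_mem_listProd n ⊤ le_top l hu hw
    have hmN : m⁻¹ * (u * z) ∈ (⊤ : Subgroup G).lowerCentralSeries (n + 2) := by
      rw [← QuotientGroup.eq, ← hmeq, QuotientGroup.mk_mul, hweq]
    exact Set.mem_mul.mpr ⟨m, hm, m⁻¹ * (u * z), hmN, mul_inv_cancel_left m (u * z)⟩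

/-- **Commutator width in nilpotent groups.** If the entries `a₁, …, a_d` of `l` generate a group `G`
whose lower central series reaches `⊥` (i.e. `G` is nilpotent), then
`[G, G] = {⁅x₁, a₁⁆ ⋯ ⁅x_d, a_d⁆ | xᵢ ∈ G}`: every element of the derived group is a product of `d`
commutators with the generators, in the order of the list.
[cite: DDMSAnalyticProP1999, Prop 1.19 (proof)] -/
theorem commutator_eq_listProd_of_lowerCentralSeries_eq_bot {l : List G}
    (hl : Subgroup.closure {a : G | a ∈ l} = ⊤) {c : ℕ}
    (hc : (⊤ : Subgroup G).lowerCentralSeries c = ⊥) :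
    (commutator G : Set G) =
      (l.map fun a => (fun y : G => ⁅y, a⁆) '' ((⊤ : Subgroup G) : Set G)).prod := by
  refine Set.Subset.antisymm ?_ (listProd_commSet_top_subset_commutator l)
  have h := commutator_subset_listProd_mul_lowerCentralSeries hl c
  have hbot : (⊤ : Subgroup G).lowerCentralSeries (c + 1) = ⊥ :=
    le_bot_iff.mp (hc ▸ Subgroup.lowerCentralSeries_antitone ⊤ (Nat.le_succ c))
  rwa [hbot, Subgroup.coe_bot, Set.singleton_one, mul_one] at h

/-- **Commutator width in nilpotent groups**, `Group.IsNilpotent` phrasing (e.g. finite `p`-groups,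
`IsPGroup.isNilpotent`). [cite: DDMSAnalyticProP1999, Prop 1.19 (proof)] -/
theorem commutator_eq_listProd_of_isNilpotent [Group.IsNilpotent G] {l : List G}
    (hl : Subgroup.closure {a : G | a ∈ l} = ⊤) :
    (commutator G : Set G) =
      (l.map fun a => (fun y : G => ⁅y, a⁆) '' ((⊤ : Subgroup G) : Set G)).prod := by
  obtain ⟨c, hc⟩ := Subgroup.nilpotent_iff_lowerCentralSeries.mp ‹Group.IsNilpotent G›
  exact commutator_eq_listProd_of_lowerCentralSeries_eq_bot hl hc

end Literature.GroupTheory
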